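import Summits.QuantumAdvantage.QuantumAdvantage.Theorems.RandomOracleGaugeVarianceAmplificationStubAverageMoments

/-!
# Crux `VarianceAmplification` (stmt-QuantumAdvantage-17874, route RandomOracleGauge), line `average-and-clip` — stub `stub_average`, part 2/2

Part 1 (`…StubAverageMoments.lean`): the product cube `Fin (m·N) → Bool` as `m` blocks, block independence,
and the moments of an independent sum. THIS PART: the averaged polynomial

  `σ = (1/m) Σ_{a<m} (rename (finProdFinEquiv (a,·)) p − E p)`   on `Fin (m·N)`,

its cube value (`evalBool_avgPoly`), degree, sup bound, mean, second and fourth moments, influences, and the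
registered stub **`stub_average`** BY NAME (witness written inline). Elementary; no named facts, no new definitions.
-/

-- D-0017: single-conjunct summit ⇒ the duplicate `QuantumAdvantage.QuantumAdvantage` is mandated.
set_option linter.dupNamespace false

noncomputable section

open Finset
open Literature.Computability.QuantumComplexity

namespace Summit.QuantumAdvantage.QuantumAdvantage.Cruxes.VarianceAmplification.AverageAndClip

namespace StubAverage

variable {N m : ℕ}

/-! ### The averaged polynomial and its cube values -/

/-- `σ(x) = (1/m) Σ_a (p(x|_block a) − E p)`. [folklore] -/
theorem evalBool_avgPoly (p : MvPolynomial (Fin N) ℝ) (x : Fin (m * N) → Bool) :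
    evalBool (MvPolynomial.C (1 / (m : ℝ)) *
        ∑ a : Fin m, (MvPolynomial.rename (fun i : Fin N => finProdFinEquiv (a, i)) p -
          MvPolynomial.C (boolAvg (evalBool p))) : MvPolynomial (Fin (m * N)) ℝ) x =
      (1 / (m : ℝ)) * ∑ a : Fin m, (evalBool p (fun i => x (finProdFinEquiv (a, i))) - boolAvg (evalBool p)) := by
  unfold evalBool
  rw [map_mul, MvPolynomial.eval_C, map_sum]
  congr 1
  refine Finset.sum_congr rfl fun a _ => ?_
  rw [map_sub, MvPolynomial.eval_C, MvPolynomial.eval_rename]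
  rfl

/-- On a glued point: `σ(glue X) = (1/m) Σ_a D(X a)`, `D = p − E p`. [folklore] -/
theorem evalBool_avgPoly_glue (p : MvPolynomial (Fin N) ℝ) (X : Fin m → Fin N → Bool) :
    evalBool (MvPolynomial.C (1 / (m : ℝ)) *
        ∑ a : Fin m, (MvPolynomial.rename (fun i : Fin N => finProdFinEquiv (a, i)) p -
          MvPolynomial.C (boolAvg (evalBool p))) : MvPolynomial (Fin (m * N)) ℝ) (fun k : Fin (m * N) => X (finProdFinEquiv.symm k).1 (finProdFinEquiv.symm k).2) =
      (1 / (m : ℝ)) * ∑ a : Fin m, (evalBool p (X a) - boolAvg (evalBool p)) := by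
  rw [evalBool_avgPoly]
  simp only [Equiv.symm_apply_apply]

/-- Degree: `deg σ ≤ deg p`. [folklore] -/
theorem totalDegree_avgPoly_le (p : MvPolynomial (Fin N) ℝ) {d : ℕ} (hp : p.totalDegree ≤ d) :
    (MvPolynomial.C (1 / (m : ℝ)) *
        ∑ a : Fin m, (MvPolynomial.rename (fun i : Fin N => finProdFinEquiv (a, i)) p -
          MvPolynomial.C (boolAvg (evalBool p))) : MvPolynomial (Fin (m * N)) ℝ).totalDegree ≤ d := by
  refine (MvPolynomial.totalDegree_mul _ _).trans ?_
  rw [MvPolynomial.totalDegree_C, zero_add]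
  refine (MvPolynomial.totalDegree_finsetSum _ _).trans (Finset.sup_le fun a _ => ?_)
  refine (MvPolynomial.totalDegree_sub _ _).trans (max_le ?_ (by simp))
  exact (MvPolynomial.totalDegree_rename_le _ _).trans hp

/-- Sup bound: `|σ| ≤ 1` for `0 ≤ p ≤ 1`. [folklore] -/
theorem abs_evalBool_avgPoly_le (p : MvPolynomial (Fin N) ℝ) (hm : 1 ≤ m)
    (hb : ∀ y, 0 ≤ evalBool p y ∧ evalBool p y ≤ 1) (x : Fin (m * N) → Bool) :
    |evalBool (MvPolynomial.C (1 / (m : ℝ)) *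
        ∑ a : Fin m, (MvPolynomial.rename (fun i : Fin N => finProdFinEquiv (a, i)) p -
          MvPolynomial.C (boolAvg (evalBool p))) : MvPolynomial (Fin (m * N)) ℝ) x| ≤ 1 := by
  rw [evalBool_avgPoly]
  have hμ0 : 0 ≤ boolAvg (evalBool p) := boolAvg_nonneg fun y => (hb y).1
  have hμ1 : boolAvg (evalBool p) ≤ 1 := by
    unfold boolAvg
    rw [div_le_one (by positivity)]
    calc ∑ y, evalBool p y ≤ ∑ _y : Fin N → Bool, (1 : ℝ) := Finset.sum_le_sum fun y _ => (hb y).2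
      _ = 2 ^ N := by simp
  have hmpos : (0 : ℝ) < m := by exact_mod_cast hm
  rw [abs_mul, abs_of_pos (by positivity : (0 : ℝ) < 1 / m), one_div, inv_mul_le_iff₀ hmpos, mul_one]
  calc |∑ a : Fin m, (evalBool p (fun i => x (finProdFinEquiv (a, i))) - boolAvg (evalBool p))|
      ≤ ∑ a : Fin m, |evalBool p (fun i => x (finProdFinEquiv (a, i))) - boolAvg (evalBool p)| :=
        Finset.abs_sum_le_sum_abs _ _
    _ ≤ ∑ _a : Fin m, (1 : ℝ) := by
        refine Finset.sum_le_sum fun a _ => ?_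
        have h1 := hb (fun i => x (finProdFinEquiv (a, i)))
        rw [abs_le]; constructor <;> linarith
    _ = m := by simp

/-! ### Moments of `σ` -/

/-- A cube average on `Fin (m·N)` as an average over block families. [folklore] -/
theorem boolAvg_eq_blocks (F : (Fin (m * N) → Bool) → ℝ) :
    boolAvg F = (∑ X : Fin m → Fin N → Bool,
      F (fun k : Fin (m * N) => X (finProdFinEquiv.symm k).1 (finProdFinEquiv.symm k).2)) / ((2 : ℝ) ^ N) ^ m := by
  unfold boolAvg
  rw [sum_cube_blocks, two_pow_mul]

/-- The centred cube function `D = p − E p` sums to `0`, `Σ D² = 2^N Var p`, `Σ D⁴ ≤ Σ D²`. [folklore] -/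
theorem centred_facts (p : MvPolynomial (Fin N) ℝ) (hb : ∀ y, 0 ≤ evalBool p y ∧ evalBool p y ≤ 1) :
    (∑ y : Fin N → Bool, (evalBool p y - boolAvg (evalBool p)) = 0) ∧
    (∑ y : Fin N → Bool, (evalBool p y - boolAvg (evalBool p)) ^ 2 = (2 : ℝ) ^ N * boolVariance p) ∧
    (∑ y : Fin N → Bool, (evalBool p y - boolAvg (evalBool p)) ^ 4 ≤
      ∑ y : Fin N → Bool, (evalBool p y - boolAvg (evalBool p)) ^ 2) := by
  have hμ0 : 0 ≤ boolAvg (evalBool p) := boolAvg_nonneg fun y => (hb y).1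
  have hμ1 : boolAvg (evalBool p) ≤ 1 := by
    unfold boolAvg
    rw [div_le_one (by positivity)]
    calc ∑ y, evalBool p y ≤ ∑ _y : Fin N → Bool, (1 : ℝ) := Finset.sum_le_sum fun y _ => (hb y).2
      _ = 2 ^ N := by simp
  refine ⟨?_, ?_, ?_⟩
  · rw [Finset.sum_sub_distrib, Finset.sum_const, Finset.card_univ, Fintype.card_fun, Fintype.card_bool,
      Fintype.card_fin, nsmul_eq_mul]
    unfold boolAvg
    push_cast
    field_simp
    ring
  · have h2N : (2 : ℝ) ^ N ≠ 0 := by positivity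
    rw [show boolVariance p = (∑ x : Fin N → Bool, (evalBool p x - boolAvg (evalBool p)) ^ 2) / (2 : ℝ) ^ N
      from rfl, mul_div_cancel₀ _ h2N]
  · refine Finset.sum_le_sum fun y _ => ?_
    have h1 : (evalBool p y - boolAvg (evalBool p)) ^ 2 ≤ 1 := by
      have := hb y
      rw [sq_le_one_iff_abs_le_one, abs_le]; constructor <;> linarith
    nlinarith [sq_nonneg (evalBool p y - boolAvg (evalBool p))]

/-- `E σ = 0`. [folklore] -/
theorem boolAvg_avgPoly (p : MvPolynomial (Fin N) ℝ) (hb : ∀ y, 0 ≤ evalBool p y ∧ evalBool p y ≤ 1) :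
    boolAvg (evalBool (MvPolynomial.C (1 / (m : ℝ)) *
        ∑ a : Fin m, (MvPolynomial.rename (fun i : Fin N => finProdFinEquiv (a, i)) p -
          MvPolynomial.C (boolAvg (evalBool p))) : MvPolynomial (Fin (m * N)) ℝ)) = 0 := by
  rw [boolAvg_eq_blocks]
  simp_rw [evalBool_avgPoly_glue]
  rw [← Finset.mul_sum, (moments _ (centred_facts p hb).1 m).1, mul_zero, zero_div]

/-- `E σ² = Var p / m`. [folklore] -/
theorem boolAvg_sq_avgPoly (p : MvPolynomial (Fin N) ℝ) (hm : 1 ≤ m)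
    (hb : ∀ y, 0 ≤ evalBool p y ∧ evalBool p y ≤ 1) :
    boolAvg (fun x => evalBool (MvPolynomial.C (1 / (m : ℝ)) *
        ∑ a : Fin m, (MvPolynomial.rename (fun i : Fin N => finProdFinEquiv (a, i)) p -
          MvPolynomial.C (boolAvg (evalBool p))) : MvPolynomial (Fin (m * N)) ℝ) x ^ 2) = boolVariance p / m := by
  rw [boolAvg_eq_blocks]
  simp_rw [evalBool_avgPoly_glue, mul_pow]
  rw [← Finset.mul_sum]
  obtain ⟨h0, h2, -⟩ := centred_facts p hb
  have hmom := (moments _ h0 m).2.1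
  rw [h2] at hmom
  have hmpos : (0 : ℝ) < m := by exact_mod_cast hm
  have h2N : (0 : ℝ) < (2 : ℝ) ^ N := by positivity
  have hsum : ∑ X : Fin m → Fin N → Bool, (∑ a, (evalBool p (X a) - boolAvg (evalBool p))) ^ 2 =
      m * boolVariance p * ((2 : ℝ) ^ N) ^ m := by
    have := hmom
    field_simp at this
    nlinarith [this]
  rw [hsum]
  field_simp

/-- `E σ⁴ ≤ Var p/m³ + 3 (Var p)²/m²`. [folklore] -/
theorem boolAvg_fourth_avgPoly (p : MvPolynomial (Fin N) ℝ) (hm : 1 ≤ m)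
    (hb : ∀ y, 0 ≤ evalBool p y ∧ evalBool p y ≤ 1) :
    boolAvg (fun x => evalBool (MvPolynomial.C (1 / (m : ℝ)) *
        ∑ a : Fin m, (MvPolynomial.rename (fun i : Fin N => finProdFinEquiv (a, i)) p -
          MvPolynomial.C (boolAvg (evalBool p))) : MvPolynomial (Fin (m * N)) ℝ) x ^ 4) ≤
      boolVariance p / (m : ℝ) ^ 3 + 3 * boolVariance p ^ 2 / (m : ℝ) ^ 2 := by
  rw [boolAvg_eq_blocks]
  simp_rw [evalBool_avgPoly_glue, mul_pow]
  rw [← Finset.mul_sum]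
  obtain ⟨h0, h2, h4⟩ := centred_facts p hb
  have hmom := (moments _ h0 m).2.2
  rw [h2] at hmom h4
  have hmpos : (0 : ℝ) < m := by exact_mod_cast hm
  have h2N : (0 : ℝ) < (2 : ℝ) ^ N := by positivity
  have hV : 0 ≤ boolVariance p := boolVariance_nonneg p
  set T := ∑ X : Fin m → Fin N → Bool, (∑ a, (evalBool p (X a) - boolAvg (evalBool p))) ^ 4 with hT
  set Q := ∑ y : Fin N → Bool, (evalBool p y - boolAvg (evalBool p)) ^ 4 with hQ
  -- `T ≤ (m V + 3 m (m-1) V²) (2^N)^m`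
  have hT_le : T ≤ (m * boolVariance p + 3 * m * ((m : ℝ) - 1) * boolVariance p ^ 2) * ((2 : ℝ) ^ N) ^ m := by
    have e : ((2 : ℝ) ^ N) ^ 2 * T = m * Q * ((2 : ℝ) ^ N) ^ (m + 1) +
        3 * m * ((m : ℝ) - 1) * ((2 : ℝ) ^ N * boolVariance p) ^ 2 * ((2 : ℝ) ^ N) ^ m := hmom
    have hQ' : m * Q * ((2 : ℝ) ^ N) ^ (m + 1) ≤ m * ((2 : ℝ) ^ N * boolVariance p) * ((2 : ℝ) ^ N) ^ (m + 1) :=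
      mul_le_mul_of_nonneg_right (mul_le_mul_of_nonneg_left h4 hmpos.le) (by positivity)
    have key : ((2 : ℝ) ^ N) ^ 2 * T ≤
        ((2 : ℝ) ^ N) ^ 2 * ((m * boolVariance p + 3 * m * ((m : ℝ) - 1) * boolVariance p ^ 2) * ((2 : ℝ) ^ N) ^ m) := by
      rw [e]
      have : ((2 : ℝ) ^ N) ^ 2 * ((m * boolVariance p + 3 * m * ((m : ℝ) - 1) * boolVariance p ^ 2) *
          ((2 : ℝ) ^ N) ^ m) = m * ((2 : ℝ) ^ N * boolVariance p) * ((2 : ℝ) ^ N) ^ (m + 1) +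
          3 * m * ((m : ℝ) - 1) * ((2 : ℝ) ^ N * boolVariance p) ^ 2 * ((2 : ℝ) ^ N) ^ m := by ring
      rw [this]; linarith
    exact le_of_mul_le_mul_left key (by positivity)
  have hm1 : (1 : ℝ) ≤ m := by exact_mod_cast hm
  calc (1 / (m : ℝ)) ^ 4 * T / ((2 : ℝ) ^ N) ^ m
      ≤ (1 / (m : ℝ)) ^ 4 * ((m * boolVariance p + 3 * m * ((m : ℝ) - 1) * boolVariance p ^ 2) *
          ((2 : ℝ) ^ N) ^ m) / ((2 : ℝ) ^ N) ^ m := by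
        apply div_le_div_of_nonneg_right _ (by positivity)
        exact mul_le_mul_of_nonneg_left hT_le (by positivity)
    _ = boolVariance p / (m : ℝ) ^ 3 + 3 * ((m : ℝ) - 1) / m * boolVariance p ^ 2 / (m : ℝ) ^ 2 := by
        field_simp
    _ ≤ boolVariance p / (m : ℝ) ^ 3 + 3 * boolVariance p ^ 2 / (m : ℝ) ^ 2 := by
        have key : 3 * ((m : ℝ) - 1) / m * boolVariance p ^ 2 / (m : ℝ) ^ 2 ≤
            3 * boolVariance p ^ 2 / (m : ℝ) ^ 2 := by
          apply div_le_div_of_nonneg_right _ (by positivity)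
          apply mul_le_mul_of_nonneg_right _ (sq_nonneg _)
          rw [div_le_iff₀ hmpos]; linarith
        linarith [key]

/-! ### Influences of `σ` -/

/-- Flipping the bit `finProdFinEquiv (a, i)` of a glued point flips bit `i` of block `a` only. [folklore] -/
theorem block_flip (X : Fin m → Fin N → Bool) (a b : Fin m) (i : Fin N) :
    (fun i' : Fin N => flipBit (finProdFinEquiv (a, i)) (fun k : Fin (m * N) => X (finProdFinEquiv.symm k).1 (finProdFinEquiv.symm k).2) (finProdFinEquiv (b, i'))) =
      Function.update X a (flipBit i (X a)) b := by
  funext i'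
  unfold flipBit
  by_cases h : (b, i') = (a, i)
  · simp only [Prod.mk.injEq] at h
    obtain ⟨rfl, rfl⟩ := h
    rw [Function.update_self, Function.update_self, Function.update_self]
    simp only [Equiv.symm_apply_apply]
  · have h' : finProdFinEquiv (b, i') ≠ finProdFinEquiv (a, i) := fun e => h (finProdFinEquiv.injective e)
    rw [Function.update_of_ne h']
    simp only [Equiv.symm_apply_apply]
    by_cases hb : b = a
    · subst hb
      have hi : i' ≠ i := fun e => h (by rw [e])
      rw [Function.update_self, Function.update_of_ne hi]
    · rw [Function.update_of_ne hb]

/-- The influence of variable `(a, i)` on `σ` is `Inf_i p / m²`. [folklore] -/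
theorem influence_avgPoly (p : MvPolynomial (Fin N) ℝ) (hm : 1 ≤ m) (a : Fin m) (i : Fin N) :
    influence (finProdFinEquiv (a, i)) (MvPolynomial.C (1 / (m : ℝ)) *
        ∑ a : Fin m, (MvPolynomial.rename (fun i : Fin N => finProdFinEquiv (a, i)) p -
          MvPolynomial.C (boolAvg (evalBool p))) : MvPolynomial (Fin (m * N)) ℝ) = influence i p / (m : ℝ) ^ 2 := by
  classical
  have hmpos : (0 : ℝ) < m := by exact_mod_cast hm
  rw [show influence (finProdFinEquiv (a, i)) (MvPolynomial.C (1 / (m : ℝ)) *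
        ∑ a : Fin m, (MvPolynomial.rename (fun i : Fin N => finProdFinEquiv (a, i)) p -
          MvPolynomial.C (boolAvg (evalBool p))) : MvPolynomial (Fin (m * N)) ℝ) =
      (∑ x : Fin (m * N) → Bool, (evalBool (MvPolynomial.C (1 / (m : ℝ)) *
        ∑ a : Fin m, (MvPolynomial.rename (fun i : Fin N => finProdFinEquiv (a, i)) p -
          MvPolynomial.C (boolAvg (evalBool p))) : MvPolynomial (Fin (m * N)) ℝ) x -
        evalBool (MvPolynomial.C (1 / (m : ℝ)) *
        ∑ a : Fin m, (MvPolynomial.rename (fun i : Fin N => finProdFinEquiv (a, i)) p -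
          MvPolynomial.C (boolAvg (evalBool p))) : MvPolynomial (Fin (m * N)) ℝ) (flipBit (finProdFinEquiv (a, i)) x)) ^ 2) / (2 : ℝ) ^ (m * N) from rfl]
  rw [sum_cube_blocks]
  -- the flipped glued point, blockwise
  have hflip : ∀ X : Fin m → Fin N → Bool,
      evalBool (MvPolynomial.C (1 / (m : ℝ)) *
        ∑ a : Fin m, (MvPolynomial.rename (fun i : Fin N => finProdFinEquiv (a, i)) p -
          MvPolynomial.C (boolAvg (evalBool p))) : MvPolynomial (Fin (m * N)) ℝ) (flipBit (finProdFinEquiv (a, i)) (fun k : Fin (m * N) => X (finProdFinEquiv.symm k).1 (finProdFinEquiv.symm k).2)) =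
        (1 / (m : ℝ)) * ∑ b : Fin m, (evalBool p (Function.update X a (flipBit i (X a)) b) - boolAvg (evalBool p)) := by
    intro X
    rw [evalBool_avgPoly]
    congr 1
    refine Finset.sum_congr rfl fun b _ => ?_
    rw [block_flip X a b i]
  simp_rw [hflip, evalBool_avgPoly_glue]
  -- the two block sums differ only in block `a`
  have hdiff : ∀ X : Fin m → Fin N → Bool,
      (1 / (m : ℝ)) * ∑ b : Fin m, (evalBool p (X b) - boolAvg (evalBool p)) -
        (1 / (m : ℝ)) * ∑ b : Fin m, (evalBool p (Function.update X a (flipBit i (X a)) b) - boolAvg (evalBool p)) =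
      (1 / (m : ℝ)) * (evalBool p (X a) - evalBool p (flipBit i (X a))) := by
    intro X
    rw [← mul_sub, ← Finset.sum_sub_distrib]
    congr 1
    rw [Finset.sum_eq_single a]
    · rw [Function.update_self]; ring
    · intro b _ hb
      rw [Function.update_of_ne hb]; ring
    · intro h; exact absurd (Finset.mem_univ a) h
  simp_rw [hdiff, mul_pow]
  rw [← Finset.mul_sum, sum_block a (fun y => (evalBool p y - evalBool p (flipBit i y)) ^ 2), two_pow_mul]
  rw [show influence i p = (∑ y : Fin N → Bool, (evalBool p y - evalBool p (flipBit i y)) ^ 2) / (2 : ℝ) ^ N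
    from rfl]
  have h2N : (0 : ℝ) < (2 : ℝ) ^ N := by positivity
  field_simp

end StubAverage

open StubAverage in
/-- **Stub `stub_average` of line `average-and-clip`** (registered signature, BY NAME): the centred average of
`m` independent copies of a `[0,1]`-bounded degree-`≤ d` polynomial has degree `≤ d`, `|σ| ≤ 1`, `E σ = 0`,
`E σ² = Var p/m`, `E σ⁴ ≤ Var p/m³ + 3(Var p)²/m²`, and `Inf_{(a,i)} σ ≤ Inf_i p/m²`.
[folklore: moments of i.i.d. sums] -/
theorem stub_average :
    ∀ (N d m : ℕ) (p : MvPolynomial (Fin N) ℝ), 1 ≤ m → p.totalDegree ≤ d →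
      (∀ x, 0 ≤ evalBool p x ∧ evalBool p x ≤ 1) →
      ∃ s : MvPolynomial (Fin (m * N)) ℝ, s.totalDegree ≤ d ∧ (∀ x, |evalBool s x| ≤ 1) ∧
        boolAvg (evalBool s) = 0 ∧
        boolAvg (fun x => evalBool s x ^ 2) = boolVariance p / m ∧
        boolAvg (fun x => evalBool s x ^ 4) ≤ boolVariance p / (m : ℝ) ^ 3 + 3 * boolVariance p ^ 2 / (m : ℝ) ^ 2 ∧
        ∀ j : Fin (m * N), ∃ i : Fin N, influence j s ≤ influence i p / (m : ℝ) ^ 2 := by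
  intro N d m p hm hdeg hb
  refine ⟨(MvPolynomial.C (1 / (m : ℝ)) *
        ∑ a : Fin m, (MvPolynomial.rename (fun i : Fin N => finProdFinEquiv (a, i)) p -
          MvPolynomial.C (boolAvg (evalBool p))) : MvPolynomial (Fin (m * N)) ℝ), totalDegree_avgPoly_le p hdeg, abs_evalBool_avgPoly_le p hm hb, boolAvg_avgPoly p hb,
    boolAvg_sq_avgPoly p hm hb, boolAvg_fourth_avgPoly p hm hb, fun j => ?_⟩
  refine ⟨(finProdFinEquiv.symm j).2, le_of_eq ?_⟩
  have hj : j = finProdFinEquiv ((finProdFinEquiv.symm j).1, (finProdFinEquiv.symm j).2) := by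
    rw [Prod.mk.eta, Equiv.apply_symm_apply]
  conv_lhs => rw [hj]
  exact influence_avgPoly p hm _ _

end Summit.QuantumAdvantage.QuantumAdvantage.Cruxes.VarianceAmplification.AverageAndClip

end
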